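import Literature.AlgebraicGeometry.Frobenioids.AutSubAmpleFiberProductCounterexample
import Literature.AlgebraicGeometry.Frobenioids.FiberProductsAutSubAmple
import HarnessLib

/-!
# [FrdI] Prop. 1.6 (vi) «Aut^sub-ample»: sharpness of the repair inside the refuting model

Mochizuki, *The geometry of Frobenioids I: the general theory*, Kyushu J. Math. **62** (2008)
293–400, §1, Proposition 1.6 (vi), kurims text p. 27 [cite: MochizukiFrdI2008, Prop. 1.6(vi) p.27].

OURS (abc-iut cell; a non-vacuity / sharpness certificate joining finding F-w5d202-1,
`AutSubAmpleFiberProductCounterexample.lean`, to abc-iut-found's repaired clause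
`PreFrobenioid.isAutSubAmple_fiberProduct_of_isometricLifts`, `FiberProductsAutSubAmple.lean`).
In ONE AND THE SAME categorical fiber product `C ×_D D′` of the witness (the model Frobenioid `C`
over the three-object base `D`, base-changed along the wide subcategory `D′`):

* the object `A = (P, (−1, 0))` — `Aut^sub`-ample, with `X = (A, P, id)` NOT `Aut^sub`-ample — has
  NO isometric endomorphism over `g` at all (`not_isIsometry_of_base_g`): every endomorphism of `A`
  of degree `d` over `g` has zero divisor with second coordinate `d`; so the hypothesis of the
  repaired clause fails at `A` exactly where the printed clause fails;
* the object `A₀ = (P, 0)` admits the ISOMETRIC lifts `(1, gʲ, 0, 0)` of all `gʲ`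
  (`isometricLifts_A0`), hence `X₀ = (A₀, P, id)` IS `Aut^sub`-ample in `C ×_D D′` by the repaired
  clause (`isAutSubAmple_X0`) — the repaired hypothesis is satisfiable in the refuting model, and the
  dividing line between `X₀` and `X` is precisely isometric liftability (`sharpness`).

Proof-level companion over landed files only; nothing here bears on [IUTchIII] Cor. 3.12.
-/

noncomputable section

namespace Literature.AlgebraicGeometry.Frobenioids

open CategoryTheory Opposite

namespace AutSubAmpleCex

/-! ### `A` has no isometric endomorphism over `g` -/

/-- `Ev` after `Φ(f)^gp` for `f : P → P`. [cite: MochizukiFrdI2008, Prop. 1.6(vi) p.27] -/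
theorem Ev_pullGp_PP (p q : ℤ) (f : BObj.P ⟶ BObj.P) (z : Algebra.GrothendieckGroup L2) :
    Ev p q (pullGp Phi f z) = Ev (p - q * f.val) q z :=
  Ev_map_shear p q f.val z

/-- Integer equations from the relation of an endomorphism of `A = (P, α)`.
[cite: MochizukiFrdI2008, Thm. 5.2(i) p.100] -/
theorem rel_A (p q : ℤ) (a : A ⟶ A) :
    (ModelFrobenioid.degFr a : ℤ) * (-p) +
        (p * (ModelFrobenioid.div a).y + q * (ModelFrobenioid.div a).x) =
      -(p - q * (ModelFrobenioid.baseMap a).val) := by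
  have h0 := ModelFrobenioid.rel a
  rw [divB_eq_one, mul_one] at h0
  have h : (Ev p q (α ^ (ModelFrobenioid.degFr a : ℕ) *
      Algebra.GrothendieckGroup.of (M := L2) (ModelFrobenioid.div a))).toAdd =
      (Ev p q (pullGp Phi (X := BObj.P) (Y := BObj.P) (ModelFrobenioid.baseMap a) α)).toAdd :=
    congrArg (fun z => (Ev p q z).toAdd) h0
  rw [map_mul, map_pow, toAdd_mul, toAdd_pow, nsmul_eq_mul, Ev_of, toAdd_ofAdd, Ev_pullGp_PP, Ev_α,
    Ev_α, toAdd_inv, toAdd_inv, toAdd_ofAdd, toAdd_ofAdd] at h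
  exact h

/-- Every endomorphism of `A` over `g` (label `1`) has zero divisor with second coordinate equal to
its Frobenius degree — in particular it is NOT isometric: the hypothesis of the repaired clause
`isAutSubAmple_fiberProduct_of_isometricLifts` fails at `A` exactly where the printed clause fails.
[cite: MochizukiFrdI2008, Prop. 1.6(vi) p.27] -/
theorem not_isIsometry_of_base_g (a : A ⟶ A) (ha : (ModelFrobenioid.baseMap a).val = 1) :
    ¬ PreFrobenioid.IsIsometry Fx a := by
  intro hiso
  have h := rel_A 0 1 a
  rw [ha] at h
  have hx : (ModelFrobenioid.div a).x = 0 := by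
    have hdiv : ModelFrobenioid.div a = 1 := hiso
    rw [hdiv]
    rfl
  norm_num at h
  omega

/-! ### `A₀ = (P, 0)` has isometric lifts, so `X₀ = (A₀, P, id)` is `Aut^sub`-ample -/

/-- The object `A₀ := (P, 0)` of `C` (trivial class). [cite: MochizukiFrdI2008, Prop. 1.6(vi) p.27] -/
def A0 : Cx := ⟨BObj.P, 1⟩

/-- The isometric lift `(1, gʲ, 0, 0)` of `gʲ : P → P` to `A₀`. [cite: MochizukiFrdI2008, Prop. 1.6(vi) p.27] -/
def lift0 (f : BObj.P ⟶ BObj.P) : A0 ⟶ A0 :=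
  ModelFrobenioid.mkHom A0 A0 1 f 1 1 (by
    rw [PNat.one_coe, pow_one, divB_eq_one, mul_one, map_one, mul_one]
    exact (map_one (pullGp Phi f)).symm)

/-- Every (sub-)endomorphism of `P = Base(A₀)` lifts to an isometric linear endomorphism of `A₀`.
[cite: MochizukiFrdI2008, Prop. 1.6(vi) p.27] -/
theorem isometricLifts_A0 :
    ∀ f ∈ autSub (PreFrobenioid.baseObj Fx A0), ∃ a : A0 ⟶ A0,
      PreFrobenioid.IsIsometry Fx a ∧ PreFrobenioid.IsLinear Fx a ∧ PreFrobenioid.Base Fx a = f :=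
  fun f _ => ⟨lift0 f, rfl, rfl, rfl⟩

/-- The object `X₀ := (A₀, P, id)` of `C ×_D D′`. [cite: MochizukiFrdI2008, Prop. 1.6(vi) p.27] -/
def X0 : PreFrobenioid.FiberProduct Fx G := ⟨A0, ⟨BObj.P⟩, Iso.refl BObj.P⟩

/-- `X₀` IS `Aut^sub`-ample in `C ×_D D′`, by abc-iut-found's repaired clause
(`isAutSubAmple_fiberProduct_of_isometricLifts`). [cite: MochizukiFrdI2008, Prop. 1.6(vi) p.27] -/
theorem isAutSubAmple_X0 : PreFrobenioid.IsAutSubAmple (PreFrobenioid.fiberProductFunctor Fx G) X0 :=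
  PreFrobenioid.isAutSubAmple_fiberProduct_of_isometricLifts isFrobenioid X0 isometricLifts_A0

/-- **Sharpness of the repair inside the refuting model**: in the same `C ×_D D′`, `X₀ = (A₀, P, id)`
(isometric lifts available) is `Aut^sub`-ample while `X = (A, P, id)` (`A` `Aut^sub`-ample but with
no isometric lift over `g`) is not. [cite: MochizukiFrdI2008, Prop. 1.6(vi) p.27] -/
theorem sharpness :
    PreFrobenioid.IsAutSubAmple (PreFrobenioid.fiberProductFunctor Fx G) X0 ∧
      PreFrobenioid.IsAutSubAmple Fx X.fst ∧
      ¬ PreFrobenioid.IsAutSubAmple (PreFrobenioid.fiberProductFunctor Fx G) X :=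
  ⟨isAutSubAmple_X0, isAutSubAmple_A, not_isAutSubAmple_X⟩

end AutSubAmpleCex

end Literature.AlgebraicGeometry.Frobenioids
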